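import Mathlib
import Literature.Computability.AlgebraicComplexity.AlderStrassen
import Summits.MatrixMultiplication.MatrixMultiplication.Theses.FidelityWitnesses

/-!
# `DiagonalPowerDecay` is functorial under contractive restrictions

Line `unit-tensor-orbit-nuclear-ratio` for the crux `FidelityWitnesses.DiagonalPowerDecay`
(`stmt-MatrixMultiplication-14053`), open stub `stub_nonnegFlatDecay` (power decay of the overlap of
rank-`≤ |ι|` tensors with ALL non-negative spectrally-flat targets `Y : ι → ι → ι → ℂ`).

This file isolates the part of that stub which the crux ALREADY controls.  A target of the form
`Y = (α, β, γ)^* ⟨n,n,n⟩`, i.e. `Y a b c = Σ_{p q r} α a p · β b q · γ c r · T_n p q r` — a RESTRICTION of the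
matrix multiplication tensor along three linear maps `ℂ^ι → ℂ^{n × n}` given by coefficient matrices
`α β γ : ι → (Fin n × Fin n) → ℂ` — satisfies, for every `S : ι → ι → ι → ℂ`,

* adjunction: `⟨S, (α,β,γ)^* T⟩ = ⟨(α,β,γ)_* S, T⟩` (`restr_overlap_pull`), where the push-forward is
  `((α,β,γ)_* S) p q r = Σ_{a b c} S a b c · α a p · β b q · γ c r`;
* rank: `R((α,β,γ)_* S) ≤ R(S)` (`restr_tensorRank_push_le`: triads push forward to triads);
* norm: if `α, β, γ` are CONTRACTIONS (`Σ_p |Σ_a x a · α a p|² ≤ Σ_a |x a|²` for all `x`), then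
  `‖(α,β,γ)_* S‖² ≤ ‖S‖²` (`restr_normSq_push_le`, one leg at a time: `restr_normSq_leg₁/₂/₃`).

Hence (`restr_capture_le_of_body`, `restr_of_diagonalPowerDecay`): every witness `(C, δ)` of the crux bounds
the overlap of every `S` of rank `≤ n²` (in ANY finite format `ι`) with every contractive restriction of
`⟨n,n,n⟩` by the same `C · n^{3-2δ} · ‖S‖²`.  Consequences for the line: the instances of `stub_nonnegFlatDecay`
at targets that are (bounded multiples of) contractive restrictions of `⟨n,n,n⟩` with `n² = O(N)` (zero-paddings
of `T_m` into larger formats, coordinate sub-tensors / partial matrix multiplications, block-diagonal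
`⊕_i ⟨m_i⟩` with `Σ m_i² ≤ n²`, …) follow from the crux itself; the stub's surplus over the crux is exactly the
class of flat non-negative targets whose matrix-multiplication factorisation norm through `M_n`, `n² = O(N)`,
is unbounded.  (Every `Y : ι³ → ℂ` is a restriction of `⟨N,N,N⟩` — `α_a = Σ_{bc} Y_abc E_{cb}`, `β_b = E_{b0}`,
`γ_c = E_{0c}` — but through the format `n = N`, where the bound `C·n^{3-2δ} = C·N^{3-2δ}` is void; already
the two-flag tensor `Σ_{i≤q} (e₀⊗e_i⊗e_i + e_i⊗e₀⊗e_i)`, `N = q+1`, `‖·‖_σ = 1`, needs factorisation norm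
at least `q^{1/4}/K^{3/4}` through `M_n` with `n² = K·N` (its `x = e₀` slice is the identity pairing of
nuclear norm `q`, while `tr(α₀ β(y) γ(z))` has nuclear norm `≤ n^{3/2}‖α₀‖_F`), although the stub holds on
it trivially: its mass is `2q ≤ 2N`.)
All statements are written over tree / Mathlib vocabulary (no auxiliary definitions).
-/

-- the tree's namespace `Summit.MatrixMultiplication.MatrixMultiplication.…` repeats a component by design
set_option linter.dupNamespace false

namespace Summit.MatrixMultiplication.MatrixMultiplication.Theorems.DiagonalPowerDecay

open scoped BigOperators
open Literature.Computability.AlgebraicComplexity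
open Summit.MatrixMultiplication.MatrixMultiplication.Theses.FidelityWitnesses (DiagonalPowerDecay)

noncomputable section

variable {ι : Type} [Fintype ι] {n : ℕ}

/-! ## Adjunction -/

omit [Fintype ι] in
/-- A triple sum over `ι` as one sum over `ι × ι × ι`. -/
theorem restr_sum3 [Fintype ι] {L : Type*} [AddCommMonoid L] (g : ι → ι → ι → L) :
    (∑ a, ∑ b, ∑ c, g a b c) = ∑ x : ι × ι × ι, g x.1 x.2.1 x.2.2 := by
  simp only [Fintype.sum_prod_type]

/-- **Adjunction**: `⟨S, (α,β,γ)^* T⟩ = ⟨(α,β,γ)_* S, T⟩` — the overlap of `S` with the restricted target is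
the overlap of the pushed-forward `S` with `T`. -/
theorem restr_overlap_pull (α β γ : ι → (Fin n × Fin n) → ℂ) (S : ι → ι → ι → ℂ)
    (T : (Fin n × Fin n) → (Fin n × Fin n) → (Fin n × Fin n) → ℂ) :
    (∑ a, ∑ b, ∑ c, S a b c * ∑ p, ∑ q, ∑ r, α a p * β b q * γ c r * T p q r) =
      ∑ p, ∑ q, ∑ r, (∑ a, ∑ b, ∑ c, S a b c * α a p * β b q * γ c r) * T p q r := by
  -- both sides equal the sextuple sum of `S a b c * α a p * β b q * γ c r * T p q r`
  have lhs : (∑ a, ∑ b, ∑ c, S a b c * ∑ p, ∑ q, ∑ r, α a p * β b q * γ c r * T p q r) =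
      ∑ x : ι × ι × ι, ∑ y : (Fin n × Fin n) × (Fin n × Fin n) × (Fin n × Fin n),
        S x.1 x.2.1 x.2.2 * α x.1 y.1 * β x.2.1 y.2.1 * γ x.2.2 y.2.2 * T y.1 y.2.1 y.2.2 := by
    rw [restr_sum3]
    refine Finset.sum_congr rfl fun x _ => ?_
    rw [restr_sum3 (fun p q r => α x.1 p * β x.2.1 q * γ x.2.2 r * T p q r), Finset.mul_sum]
    exact Finset.sum_congr rfl fun y _ => by ring
  have rhs : (∑ p, ∑ q, ∑ r, (∑ a, ∑ b, ∑ c, S a b c * α a p * β b q * γ c r) * T p q r) =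
      ∑ y : (Fin n × Fin n) × (Fin n × Fin n) × (Fin n × Fin n), ∑ x : ι × ι × ι,
        S x.1 x.2.1 x.2.2 * α x.1 y.1 * β x.2.1 y.2.1 * γ x.2.2 y.2.2 * T y.1 y.2.1 y.2.2 := by
    rw [restr_sum3 (fun p q r => (∑ a, ∑ b, ∑ c, S a b c * α a p * β b q * γ c r) * T p q r)]
    refine Finset.sum_congr rfl fun y _ => ?_
    rw [restr_sum3 (fun a b c => S a b c * α a y.1 * β b y.2.1 * γ c y.2.2), Finset.sum_mul]
  rw [lhs, rhs, Finset.sum_comm]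

/-! ## Rank does not increase -/

/-- The push-forward of a triad `w ⊗ u ⊗ v` is the triad of the pushed vectors
`(Σ_a w a · α a ·) ⊗ (Σ_b u b · β b ·) ⊗ (Σ_c v c · γ c ·)`. -/
theorem restr_push_triad (α β γ : ι → (Fin n × Fin n) → ℂ) (w u v : ι → ℂ) :
    (fun p q r => ∑ a, ∑ b, ∑ c, triad w u v a b c * α a p * β b q * γ c r) =
      triad (fun p => ∑ a, w a * α a p) (fun q => ∑ b, u b * β b q) (fun r => ∑ c, v c * γ c r) := by
  funext p q r
  simp only [triad_apply]
  have e : (∑ a, w a * α a p) * (∑ b, u b * β b q) * (∑ c, v c * γ c r)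
      = ∑ a, ∑ b, ∑ c, (w a * α a p) * ((u b * β b q) * (v c * γ c r)) := by
    rw [mul_assoc]
    simp only [Finset.mul_sum, Finset.sum_mul]
    -- `simp` leaves the binders in the order `c, b, a`; commute them back
    calc (∑ c, ∑ b, ∑ a, w a * α a p * (u b * β b q * (v c * γ c r)))
        = ∑ c, ∑ a, ∑ b, w a * α a p * (u b * β b q * (v c * γ c r)) :=
          Finset.sum_congr rfl fun c _ => Finset.sum_comm
      _ = ∑ a, ∑ c, ∑ b, w a * α a p * (u b * β b q * (v c * γ c r)) := Finset.sum_comm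
      _ = ∑ a, ∑ b, ∑ c, w a * α a p * (u b * β b q * (v c * γ c r)) :=
          Finset.sum_congr rfl fun a _ => Finset.sum_comm
  rw [e]
  exact Finset.sum_congr rfl fun a _ => Finset.sum_congr rfl fun b _ =>
    Finset.sum_congr rfl fun c _ => by ring

/-- The push-forward is additive over finite sums of tensors. -/
theorem restr_push_sum {m : ℕ} (α β γ : ι → (Fin n × Fin n) → ℂ) (F : Fin m → ι → ι → ι → ℂ) :
    (fun p q r => ∑ a, ∑ b, ∑ c, (∑ l, F l) a b c * α a p * β b q * γ c r) =
      ∑ l, fun p q r => ∑ a, ∑ b, ∑ c, F l a b c * α a p * β b q * γ c r := by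
  funext p q r
  simp only [Finset.sum_apply]
  calc (∑ a, ∑ b, ∑ c, (∑ l, F l a b c) * α a p * β b q * γ c r)
      = ∑ a, ∑ b, ∑ c, ∑ l, F l a b c * α a p * β b q * γ c r := by
        simp only [Finset.sum_mul]
    _ = ∑ a, ∑ b, ∑ l, ∑ c, F l a b c * α a p * β b q * γ c r :=
        Finset.sum_congr rfl fun a _ => Finset.sum_congr rfl fun b _ => Finset.sum_comm
    _ = ∑ a, ∑ l, ∑ b, ∑ c, F l a b c * α a p * β b q * γ c r :=
        Finset.sum_congr rfl fun a _ => Finset.sum_comm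
    _ = ∑ l, ∑ a, ∑ b, ∑ c, F l a b c * α a p * β b q * γ c r := Finset.sum_comm

/-- **Rank does not increase under push-forward**: `R((α,β,γ)_* S) ≤ R(S)` (triads push forward to
triads). -/
theorem restr_tensorRank_push_le [DecidableEq ι] (α β γ : ι → (Fin n × Fin n) → ℂ)
    (S : ι → ι → ι → ℂ) :
    tensorRank (fun p q r => ∑ a, ∑ b, ∑ c, S a b c * α a p * β b q * γ c r) ≤ tensorRank S := by
  obtain ⟨w, u, v, h⟩ := exists_eq_sum_triad_of_tensorRank_le (le_refl (tensorRank S))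
  have e1 : (fun p q r => ∑ a, ∑ b, ∑ c, S a b c * α a p * β b q * γ c r) =
      ∑ i, fun p q r => ∑ a, ∑ b, ∑ c, triad (w i) (u i) (v i) a b c * α a p * β b q * γ c r := by
    have := congrArg
      (fun S' : ι → ι → ι → ℂ => fun p q r => ∑ a, ∑ b, ∑ c, S' a b c * α a p * β b q * γ c r) h
    rw [this]
    exact restr_push_sum α β γ _
  exact tensorRank_le_of_eq_sum (fun l p => ∑ a, w l a * α a p) (fun l q => ∑ b, u l b * β b q)
    (fun l r => ∑ c, v l c * γ c r)
    (e1.trans (Finset.sum_congr rfl fun l _ => restr_push_triad α β γ (w l) (u l) (v l)))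

/-! ## Norm does not increase under contractive push-forward (one leg at a time) -/

/-- Contracting the FIRST leg does not increase the squared norm. -/
theorem restr_normSq_leg₁ {α : ι → (Fin n × Fin n) → ℂ}
    (hα : ∀ x : ι → ℂ, (∑ p, ‖∑ a, x a * α a p‖ ^ 2) ≤ ∑ a, ‖x a‖ ^ 2)
    {κ μ : Type} [Fintype κ] [Fintype μ] (S : ι → κ → μ → ℂ) :
    (∑ p, ∑ b, ∑ c, ‖∑ a, S a b c * α a p‖ ^ 2) ≤ ∑ a, ∑ b, ∑ c, ‖S a b c‖ ^ 2 := by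
  calc (∑ p, ∑ b, ∑ c, ‖∑ a, S a b c * α a p‖ ^ 2)
      = ∑ b, ∑ p, ∑ c, ‖∑ a, S a b c * α a p‖ ^ 2 := Finset.sum_comm
    _ = ∑ b, ∑ c, ∑ p, ‖∑ a, S a b c * α a p‖ ^ 2 :=
        Finset.sum_congr rfl fun b _ => Finset.sum_comm
    _ ≤ ∑ b, ∑ c, ∑ a, ‖S a b c‖ ^ 2 :=
        Finset.sum_le_sum fun b _ => Finset.sum_le_sum fun c _ => hα (fun a => S a b c)
    _ = ∑ b, ∑ a, ∑ c, ‖S a b c‖ ^ 2 := Finset.sum_congr rfl fun b _ => Finset.sum_comm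
    _ = ∑ a, ∑ b, ∑ c, ‖S a b c‖ ^ 2 := Finset.sum_comm

/-- Contracting the SECOND leg does not increase the squared norm. -/
theorem restr_normSq_leg₂ {β : ι → (Fin n × Fin n) → ℂ}
    (hβ : ∀ x : ι → ℂ, (∑ p, ‖∑ a, x a * β a p‖ ^ 2) ≤ ∑ a, ‖x a‖ ^ 2)
    {κ μ : Type} [Fintype κ] [Fintype μ] (S : κ → ι → μ → ℂ) :
    (∑ a, ∑ q, ∑ c, ‖∑ b, S a b c * β b q‖ ^ 2) ≤ ∑ a, ∑ b, ∑ c, ‖S a b c‖ ^ 2 := by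
  refine Finset.sum_le_sum fun a _ => ?_
  calc (∑ q, ∑ c, ‖∑ b, S a b c * β b q‖ ^ 2)
      = ∑ c, ∑ q, ‖∑ b, S a b c * β b q‖ ^ 2 := Finset.sum_comm
    _ ≤ ∑ c, ∑ b, ‖S a b c‖ ^ 2 := Finset.sum_le_sum fun c _ => hβ (fun b => S a b c)
    _ = ∑ b, ∑ c, ‖S a b c‖ ^ 2 := Finset.sum_comm

/-- Contracting the THIRD leg does not increase the squared norm. -/
theorem restr_normSq_leg₃ {γ : ι → (Fin n × Fin n) → ℂ}
    (hγ : ∀ x : ι → ℂ, (∑ p, ‖∑ a, x a * γ a p‖ ^ 2) ≤ ∑ a, ‖x a‖ ^ 2)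
    {κ μ : Type} [Fintype κ] [Fintype μ] (S : κ → μ → ι → ℂ) :
    (∑ a, ∑ b, ∑ r, ‖∑ c, S a b c * γ c r‖ ^ 2) ≤ ∑ a, ∑ b, ∑ c, ‖S a b c‖ ^ 2 :=
  Finset.sum_le_sum fun a _ => Finset.sum_le_sum fun b _ => hγ (fun c => S a b c)

/-- The push-forward as three nested one-leg contractions:
`((α,β,γ)_* S) p q r = Σ_c (Σ_b (Σ_a S a b c · α a p) · β b q) · γ c r`. -/
theorem restr_push_eq_legs (α β γ : ι → (Fin n × Fin n) → ℂ) (S : ι → ι → ι → ℂ)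
    (p q r : Fin n × Fin n) :
    (∑ a, ∑ b, ∑ c, S a b c * α a p * β b q * γ c r) =
      ∑ c, (∑ b, (∑ a, S a b c * α a p) * β b q) * γ c r := by
  simp only [Finset.sum_mul]
  calc (∑ a, ∑ b, ∑ c, S a b c * α a p * β b q * γ c r)
      = ∑ a, ∑ c, ∑ b, S a b c * α a p * β b q * γ c r :=
        Finset.sum_congr rfl fun a _ => Finset.sum_comm
    _ = ∑ c, ∑ a, ∑ b, S a b c * α a p * β b q * γ c r := Finset.sum_comm
    _ = ∑ c, ∑ b, ∑ a, S a b c * α a p * β b q * γ c r :=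
        Finset.sum_congr rfl fun c _ => Finset.sum_comm

/-- **Norm does not increase under a contractive push-forward**: `‖(α,β,γ)_* S‖² ≤ ‖S‖²`. -/
theorem restr_normSq_push_le {α β γ : ι → (Fin n × Fin n) → ℂ}
    (hα : ∀ x : ι → ℂ, (∑ p, ‖∑ a, x a * α a p‖ ^ 2) ≤ ∑ a, ‖x a‖ ^ 2)
    (hβ : ∀ x : ι → ℂ, (∑ p, ‖∑ a, x a * β a p‖ ^ 2) ≤ ∑ a, ‖x a‖ ^ 2)
    (hγ : ∀ x : ι → ℂ, (∑ p, ‖∑ a, x a * γ a p‖ ^ 2) ≤ ∑ a, ‖x a‖ ^ 2) (S : ι → ι → ι → ℂ) :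
    (∑ p, ∑ q, ∑ r, ‖∑ a, ∑ b, ∑ c, S a b c * α a p * β b q * γ c r‖ ^ 2) ≤
      ∑ a, ∑ b, ∑ c, ‖S a b c‖ ^ 2 := by
  simp_rw [restr_push_eq_legs]
  -- peel the legs: third, then second, then first
  calc (∑ p, ∑ q, ∑ r, ‖∑ c, (∑ b, (∑ a, S a b c * α a p) * β b q) * γ c r‖ ^ 2)
      ≤ ∑ p, ∑ q, ∑ c, ‖∑ b, (∑ a, S a b c * α a p) * β b q‖ ^ 2 :=
        restr_normSq_leg₃ hγ (fun p q c => ∑ b, (∑ a, S a b c * α a p) * β b q)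
    _ ≤ ∑ p, ∑ b, ∑ c, ‖∑ a, S a b c * α a p‖ ^ 2 :=
        restr_normSq_leg₂ hβ (fun p b c => ∑ a, S a b c * α a p)
    _ ≤ ∑ a, ∑ b, ∑ c, ‖S a b c‖ ^ 2 := restr_normSq_leg₁ hα S

/-! ## The crux controls every contractive restriction of `⟨n,n,n⟩` -/

/-- **Functoriality of the crux under contractive restriction.**  If `(C, δ)` witnesses the body of
`DiagonalPowerDecay` (for all `n` and all `S` of rank `≤ n²` in the matrix format) and `0 ≤ C`, then for EVERY
finite format `ι`, every three contractions `α β γ : ℓ²(ι) → ℓ²(Fin n × Fin n)` (given by coefficient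
matrices) and every `S : ι³ → ℂ` of rank `≤ n²`, the overlap of `S` with the restricted target
`(α,β,γ)^* ⟨n,n,n⟩ = (a b c ↦ Σ_{pqr} α a p · β b q · γ c r · T p q r)` obeys the same bound
`|⟨S, (α,β,γ)^*T_n⟩|² ≤ C · n^{3-2δ} · ‖S‖²`. -/
theorem restr_capture_le_of_body [DecidableEq ι] {C δ : ℝ} (hC : 0 ≤ C)
    (hB : ∀ (n : ℕ) (S : (Fin n × Fin n) → (Fin n × Fin n) → (Fin n × Fin n) → ℂ),
      tensorRank S ≤ n ^ 2 →
        ‖∑ a, ∑ b, ∑ c, S a b c * matMulTensor ℂ n n n a b c‖ ^ 2 ≤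
          C * (n : ℝ) ^ (3 - 2 * δ) * ∑ a, ∑ b, ∑ c, ‖S a b c‖ ^ 2)
    {α β γ : ι → (Fin n × Fin n) → ℂ}
    (hα : ∀ x : ι → ℂ, (∑ p, ‖∑ a, x a * α a p‖ ^ 2) ≤ ∑ a, ‖x a‖ ^ 2)
    (hβ : ∀ x : ι → ℂ, (∑ p, ‖∑ a, x a * β a p‖ ^ 2) ≤ ∑ a, ‖x a‖ ^ 2)
    (hγ : ∀ x : ι → ℂ, (∑ p, ‖∑ a, x a * γ a p‖ ^ 2) ≤ ∑ a, ‖x a‖ ^ 2)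
    (S : ι → ι → ι → ℂ) (hS : tensorRank S ≤ n ^ 2) :
    ‖∑ a, ∑ b, ∑ c, S a b c *
        ∑ p, ∑ q, ∑ r, α a p * β b q * γ c r * matMulTensor ℂ n n n p q r‖ ^ 2 ≤
      C * (n : ℝ) ^ (3 - 2 * δ) * ∑ a, ∑ b, ∑ c, ‖S a b c‖ ^ 2 := by
  rw [restr_overlap_pull]
  have hrank : tensorRank (fun p q r => ∑ a, ∑ b, ∑ c, S a b c * α a p * β b q * γ c r) ≤ n ^ 2 :=
    (restr_tensorRank_push_le α β γ S).trans hS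
  have hn : 0 ≤ C * (n : ℝ) ^ (3 - 2 * δ) :=
    mul_nonneg hC (Real.rpow_nonneg (Nat.cast_nonneg n) _)
  have key := hB n (fun p q r => ∑ a, ∑ b, ∑ c, S a b c * α a p * β b q * γ c r) hrank
  exact key.trans (mul_le_mul_of_nonneg_left (restr_normSq_push_le hα hβ hγ S) hn)

/-- Enlarging the constant of a witness of the body of the crux to `max C 0` keeps it a witness. -/
theorem restr_body_mono {C δ : ℝ}
    (hB : ∀ (n : ℕ) (S : (Fin n × Fin n) → (Fin n × Fin n) → (Fin n × Fin n) → ℂ),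
      tensorRank S ≤ n ^ 2 →
        ‖∑ a, ∑ b, ∑ c, S a b c * matMulTensor ℂ n n n a b c‖ ^ 2 ≤
          C * (n : ℝ) ^ (3 - 2 * δ) * ∑ a, ∑ b, ∑ c, ‖S a b c‖ ^ 2) :
    ∀ (n : ℕ) (S : (Fin n × Fin n) → (Fin n × Fin n) → (Fin n × Fin n) → ℂ),
      tensorRank S ≤ n ^ 2 →
        ‖∑ a, ∑ b, ∑ c, S a b c * matMulTensor ℂ n n n a b c‖ ^ 2 ≤
          max C 0 * (n : ℝ) ^ (3 - 2 * δ) * ∑ a, ∑ b, ∑ c, ‖S a b c‖ ^ 2 := by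
  intro n S hS
  refine (hB n S hS).trans ?_
  have h1 : 0 ≤ (n : ℝ) ^ (3 - 2 * δ) := Real.rpow_nonneg (Nat.cast_nonneg n) _
  have h2 : 0 ≤ ∑ a, ∑ b, ∑ c, ‖S a b c‖ ^ 2 := by positivity
  exact mul_le_mul_of_nonneg_right (mul_le_mul_of_nonneg_right (le_max_left C 0) h1) h2

/-- **`DiagonalPowerDecay` controls all contractive restrictions of `⟨n,n,n⟩`, in every format.**
From the crux: some `C` and `δ > 0` bound `|⟨S, (α,β,γ)^* T_n⟩|² ≤ C·n^{3-2δ}·‖S‖²` for every finite index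
type `ι`, all contractions `α β γ : ℓ²(ι) → ℓ²(Fin n × Fin n)`, and every `S : ι³ → ℂ` of rank `≤ n²` — in
particular for every `S` of rank `≤ |ι|` whenever `|ι| ≤ n²` (the orbit points of `stub_nonnegFlatDecay`):
on restricted-matrix-multiplication targets the open stub of line `unit-tensor-orbit-nuclear-ratio` carries
no content beyond the crux. -/
theorem restr_of_diagonalPowerDecay (hD : DiagonalPowerDecay) :
    ∃ C δ : ℝ, 0 < δ ∧ ∀ (ι : Type) [Fintype ι] [DecidableEq ι] (n : ℕ)
      (α β γ : ι → (Fin n × Fin n) → ℂ),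
      (∀ x : ι → ℂ, (∑ p, ‖∑ a, x a * α a p‖ ^ 2) ≤ ∑ a, ‖x a‖ ^ 2) →
      (∀ x : ι → ℂ, (∑ p, ‖∑ a, x a * β a p‖ ^ 2) ≤ ∑ a, ‖x a‖ ^ 2) →
      (∀ x : ι → ℂ, (∑ p, ‖∑ a, x a * γ a p‖ ^ 2) ≤ ∑ a, ‖x a‖ ^ 2) →
      ∀ S : ι → ι → ι → ℂ, tensorRank S ≤ n ^ 2 →
        ‖∑ a, ∑ b, ∑ c, S a b c *
            ∑ p, ∑ q, ∑ r, α a p * β b q * γ c r * matMulTensor ℂ n n n p q r‖ ^ 2 ≤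
          C * (n : ℝ) ^ (3 - 2 * δ) * ∑ a, ∑ b, ∑ c, ‖S a b c‖ ^ 2 := by
  obtain ⟨C, δ, hδ, hB⟩ := hD
  refine ⟨max C 0, δ, hδ, fun ι _ _ n α β γ hα hβ hγ S hS => ?_⟩
  exact restr_capture_le_of_body (le_max_right C 0) (restr_body_mono hB) hα hβ hγ S hS

end

end Summit.MatrixMultiplication.MatrixMultiplication.Theorems.DiagonalPowerDecay
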